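import Summits.CriticalPhenomena.CardyFormulaZ2.Theorems.CardyUniqueLimitCardyRigiditySlitDuality
import HarnessLib

/-!
# Slit duality, II: no slit crossing forces a dual slit crossing (the covering half)

Crux `Summit.CriticalPhenomena.CardyFormulaZ2.Theses.CardyUniqueLimit.CardyRigidity`
(stmt-CriticalPhenomena-0746), line `crossing_martingale`, stub `stub_slitObservableApprox`
(THE HEART), piece (P-approx) "exact slit duality", covering half `slitCrossing ∪ dualSlitCrossing
= univ` (the half that turns an upper bound for the dual event into a LOWER bound for the slit
crossing probability, `P(slit) ≥ 1 - P(dual slit)`).  Vocabulary: `…SlitDuality.lean`.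

The proof is the parity/handshake argument of `PlanarDuality.lean` ("at least one") transplanted
from rectangles to the slit structure of an exploration prefix of admissible Dobrushin data.
Colour a site when it is joined in the slit graph to `X₂ ∪ leftBank`; if no site of `X₁` is
coloured, look at the inner faces dual-reachable from the dual sources and count their
BICHROMATIC sides (endpoints of different colours): every face has an even number of them
(`even_card_bichromatic_faceSide`); a bichromatic side is never an unrevealed open free edge, and
a revealed open one has both endpoints on the left bank, so a bichromatic side is either closed in
the completed frozen configuration — a dual step, towards an inner face as long as the face is not
a dual target (`isInnerFace_faceNbr_of_not_mem_target`) — or a wired `A`–`A` edge, which under the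
no-chord hypothesis is a boundary edge and by the covering hypothesis a designated gap edge
(`mem_gap_of_bichromatic_of_mem`).  Dual steps pair up under "cross the side"
(`faceNbr_faceNbr`, an involution without fixed points: even count), while the bichromatic gap
edges are in bijection with the colour changes along the wired boundary path from `a` (coloured)
to `X₁` (uncoloured) — an odd number (`walk_bichromatic_parity`).  Contradiction.

Hypotheses (all on the geometry of `Ω_δ` and the designated edge sets, none on `ω`): gap edges are
wired sides of inner faces; NO WIRED CHORD (an `A`–`A` edge is a side of at most one inner face —
necessary: a one-face-wide slot of the wired arc defeats the dichotomy); every wired boundary edge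
lies inside `X₂`, inside `X₁`, in `𝒢` or in `ℱ`; and a boundary path of wired edges from `a` to a
site of `X₁` passes every gap edge exactly once and otherwise stays inside `X₂` or `X₁`.
-/

noncomputable section

open MeasureTheory Set
open Literature.Probability Literature.Probability.LatticeModels Literature.Probability.Percolation
open Literature.Probability.LatticeModels.DiscreteDobrushin
open Summit.CriticalPhenomena.CardyFormulaZ2.Cruxes.ParafermionToSLESixFamilies.CaratheodoryNetSlitUniformity
  (revealedFreeEdges freeze)

namespace Summit.CriticalPhenomena.CardyFormulaZ2.Cruxes.CardyRigidity.CrossingMartingale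

namespace EventIdentity

section Covering

variable {D : DiscreteDobrushin}

/-! ### Bichromatic edges of a colouring: parity along walks and around faces -/

/-- The BICHROMATIC edges of a colouring `c` (a set of coloured vertices): those with exactly one
coloured endpoint. [cite: BollobasRiordan2006, Ch. 3, Lemma 1] -/
def bichromaticEdges {V : Type*} (c : Set V) : Set (Sym2 V) := {e | ∃ a b, e = s(a, b) ∧ a ∈ c ∧ b ∉ c}

/-- Bichromatic, for an explicit pair. [folklore] -/
theorem mk_mem_bichromaticEdges_iff {V : Type*} {c : Set V} {a b : V} :
    s(a, b) ∈ bichromaticEdges c ↔ (a ∈ c ∧ b ∉ c) ∨ (b ∈ c ∧ a ∉ c) := by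
  constructor
  · rintro ⟨a', b', h, ha', hb'⟩
    rcases Sym2.eq_iff.1 h with ⟨rfl, rfl⟩ | ⟨rfl, rfl⟩
    · exact Or.inl ⟨ha', hb'⟩
    · exact Or.inr ⟨ha', hb'⟩
  · rintro (⟨ha, hb⟩ | ⟨hb, ha⟩)
    · exact ⟨a, b, rfl, ha, hb⟩
    · exact ⟨b, a, Sym2.eq_swap, hb, ha⟩

/-- A monochromatic edge is not bichromatic. [folklore] -/
theorem not_mem_bichromaticEdges_of_forall {V : Type*} {c : Set V} {e : Sym2 V}
    (h : (∀ x ∈ e, x ∈ c) ∨ ∀ x ∈ e, x ∉ c) : e ∉ bichromaticEdges c := by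
  rintro ⟨a, b, rfl, ha, hb⟩
  rcases h with h | h
  · exact hb (h b (Sym2.mem_mk_right _ _))
  · exact h a (Sym2.mem_mk_left _ _) ha

open scoped Classical in
/-- **Parity of colour changes along a walk**: the number of bichromatic edges along a walk is,
modulo `2`, the indicator that its endpoints have different colours. [folklore] -/
theorem walk_bichromatic_parity {V : Type*} {G : SimpleGraph V} (c : Set V) :
    ∀ {u v : V} (p : G.Walk u v),
      (((p.edges.filter fun e ↦ decide (e ∈ bichromaticEdges c)).length : ℕ) : ZMod 2) =
        (if u ∈ c then 1 else 0) + (if v ∈ c then 1 else 0)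
  | u, _, SimpleGraph.Walk.nil => by
    have h2 : ∀ x : ZMod 2, x + x = 0 := by decide
    simp only [SimpleGraph.Walk.edges_nil, List.filter_nil, List.length_nil, Nat.cast_zero, h2]
  | u, v, SimpleGraph.Walk.cons (v := w) hadj p => by
    rw [SimpleGraph.Walk.edges_cons, List.filter_cons]
    have ih := walk_bichromatic_parity c p
    have h2 : ∀ x : ZMod 2, x + x = 0 := by decide
    by_cases hb : s(u, w) ∈ bichromaticEdges c
    · rw [decide_eq_true hb, if_pos rfl, List.length_cons, Nat.cast_succ, ih]
      rw [mk_mem_bichromaticEdges_iff] at hb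
      rcases hb with ⟨hu, hw⟩ | ⟨hw, hu⟩
      · simp only [hu, hw, if_true, if_false, zero_add]
        exact add_comm _ _
      · simp only [hu, hw, if_true, if_false, zero_add]
        rw [add_comm (1 : ZMod 2), add_assoc, h2, add_zero]
    · rw [decide_eq_false hb, if_neg Bool.false_ne_true, ih]
      rw [mk_mem_bichromaticEdges_iff] at hb
      by_cases hu : u ∈ c
      · have hw : w ∈ c := by by_contra hw; exact hb (Or.inl ⟨hu, hw⟩)
        simp only [hu, hw, if_true]
      · have hw : w ∉ c := fun hw ↦ hb (Or.inr ⟨hw, hu⟩)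
        simp only [hu, hw, if_false]

open scoped Classical in
/-- **Every face has an even number of bichromatic sides** (a cyclic `0/1`-sequence of length
four changes an even number of times). [folklore] -/
theorem even_card_bichromatic_faceSide (c : Set (Site 2)) (f : Site 2) :
    Even ((Finset.univ.filter fun j ↦ faceSide f j ∈ bichromaticEdges c).card) := by
  have key : ∀ b : Fin 4 → Bool, Even ((Finset.univ.filter fun j ↦ b j ≠ b (j + 1)).card) := by decide
  convert key (fun j ↦ decide (f + cornerOff j ∈ c)) using 2
  ext j
  simp only [Finset.mem_filter, Finset.mem_univ, true_and, faceSide_eq, mk_mem_bichromaticEdges_iff, ne_eq,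
    decide_eq_decide]
  tauto

/-! ### The colouring by the slit cluster of `X₂ ∪ leftBank` -/

variable {hD : D.IsZdAdmissible} {X₁ X₂ : Set (Site 2)} {𝒢 ℱ : Set (Sym2 (Site 2))}
  {ω₀ ω : BondConfig (Site 2)} {n : ℕ}

/-- The coloured sites: those joined in the slit graph to `X₂ ∪ leftBank`. [cite: CamiaNewman2007, §5] -/
def slitColoured (hD : D.IsZdAdmissible) (X₂ : Set (Site 2)) (ω₀ : BondConfig (Site 2)) (n : ℕ)
    (ω : BondConfig (Site 2)) : Set (Site 2) :=
  {v | ∃ y ∈ X₂ ∪ leftBank hD ω₀ n, (slitGraph hD ω₀ n ω).Reachable v y}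

/-- Sites of `X₂` and of the left bank are coloured. [folklore] -/
theorem mem_slitColoured_of_mem {v : Site 2} (hv : v ∈ X₂ ∪ leftBank hD ω₀ n) : v ∈ slitColoured hD X₂ ω₀ n ω :=
  ⟨v, hv, SimpleGraph.Reachable.refl _⟩

/-- The slit crossing event is "some site of `X₁` is coloured". [folklore] -/
theorem mem_slitCrossing_iff_exists_mem_slitColoured :
    ω ∈ slitCrossing hD X₁ X₂ ω₀ n ↔ ∃ x ∈ X₁, x ∈ slitColoured hD X₂ ω₀ n ω := Iff.rfl

/-- A bichromatic edge is not an edge of the slit graph. [folklore] -/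
theorem not_slit_of_mem_bichromaticEdges {e : Sym2 (Site 2)}
    (hb : e ∈ bichromaticEdges (slitColoured hD X₂ ω₀ n ω)) :
    ¬ (D.IsFreeEdge e ∧ e ∈ ω ∧ e ∉ revealedFreeEdges hD ω₀ n) := by
  obtain ⟨a, b, rfl, ⟨y, hy, hr⟩, hb⟩ := hb
  intro h
  exact hb ⟨y, hy, (SimpleGraph.Adj.reachable (slitGraph_adj.2 h)).symm.trans hr⟩

/-- **A bichromatic edge of `Ω_δ` that is not crossed is a wired `A`–`A` edge** (it is not an
unrevealed open free edge, and a revealed open free edge has both endpoints on the left bank).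
[cite: CamiaNewman2007, §5] -/
theorem zdArcA_of_mem_bichromaticEdges_of_mem {e : Sym2 (Site 2)}
    (hb : e ∈ bichromaticEdges (slitColoured hD X₂ ω₀ n ω))
    (he : e ∈ (discreteDomainGraph D.Ω D.δ).edgeSet) (hm : e ∈ D.bcBondConfig (freeze hD ω₀ n ω)) :
    ∀ x ∈ e, x ∈ D.zdArcA := by
  obtain ⟨-, hA | ⟨hfr, hB⟩⟩ := (D.mem_bcBondConfig_iff).1 hm
  · exact hA
  · by_contra hA
    have hfree : D.IsFreeEdge e := ⟨he, hB, hA⟩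
    simp only [freeze, mem_union, mem_sdiff, mem_inter_iff] at hfr
    rcases hfr with ⟨hω, hR⟩ | ⟨hω₀, hR⟩
    · exact not_slit_of_mem_bichromaticEdges hb ⟨hfree, hω, hR⟩
    · obtain ⟨a, b, rfl, -, hb'⟩ := hb
      exact hb' (mem_slitColoured_of_mem (Or.inr (mem_leftBank_of_mem_revealedFreeEdges
        (self_mem_explorationCylinder ω₀ n) hR hω₀ (Sym2.mem_mk_right _ _))))

/-- **Off the dual targets, a crossed side leads to an inner face**: otherwise the side is a
boundary edge, not wired, hence touching `B`, and the face has a corner on `B`. [cite: Smirnov2001, §2] -/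
theorem isInnerFace_faceNbr_of_not_mem_target {f : Site 2} (hf : D.IsInnerFace f)
    (hT : f ∉ dualSlitTarget hD ℱ ω₀ n) {j : Fin 4} (hc : faceSide f j ∉ D.bcBondConfig (freeze hD ω₀ n ω)) :
    D.IsInnerFace (faceNbr f j) := by
  by_contra hn
  have harcs := IsInnerFaceSide.arcs_of_not_isInnerFace_faceNbr hD hf hn
  have hnotA : ¬ ∀ x ∈ faceSide f j, x ∈ D.zdArcA := fun hA ↦
    hc (mem_bcBondConfig_freeze_of_zdArcA (IsInnerFaceSide.faceSide_mem_edgeSet hf j) hA)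
  push Not at hnotA
  obtain ⟨x, hx, hxA⟩ := hnotA
  have hxB : x ∈ D.zdArcB := (harcs x hx).resolve_left hxA
  refine hT ⟨hf, Or.inr (Or.inr ?_)⟩
  rw [faceSide_eq] at hx
  rcases Sym2.mem_iff.1 hx with rfl | rfl
  · exact ⟨j, hxB⟩
  · exact ⟨j + 1, hxB⟩

/-- **Off the dual targets and without wired chords, an uncrossed bichromatic side of an inner
face is a designated gap edge** (it is wired, hence by the no-chord hypothesis a boundary edge,
and the covering hypothesis leaves only `𝒢`: sides inside `X₂` or `X₁` are monochromatic, sides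
in `ℱ` make the face a target). [cite: CamiaNewman2007, §5] -/
theorem mem_gap_of_bichromatic_of_mem
    (hchord : ∀ f f' : Site 2, ∀ j j' : Fin 4, D.IsInnerFace f → D.IsInnerFace f' →
      faceSide f j = faceSide f' j' → (∀ x ∈ faceSide f j, x ∈ D.zdArcA) → f = f')
    (hcover : ∀ (f : Site 2) (j : Fin 4), D.IsInnerFace f → ¬ D.IsInnerFace (faceNbr f j) →
      (∀ x ∈ faceSide f j, x ∈ D.zdArcA) → (∀ x ∈ faceSide f j, x ∈ X₂) ∨
        (∀ x ∈ faceSide f j, x ∈ X₁) ∨ faceSide f j ∈ 𝒢 ∨ faceSide f j ∈ ℱ)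
    (hX₁ : ∀ x ∈ X₁, x ∉ slitColoured hD X₂ ω₀ n ω) {f : Site 2} (hf : D.IsInnerFace f)
    (hT : f ∉ dualSlitTarget hD ℱ ω₀ n) {j : Fin 4}
    (hb : faceSide f j ∈ bichromaticEdges (slitColoured hD X₂ ω₀ n ω))
    (hm : faceSide f j ∈ D.bcBondConfig (freeze hD ω₀ n ω)) : faceSide f j ∈ 𝒢 := by
  have hA := zdArcA_of_mem_bichromaticEdges_of_mem hb (IsInnerFaceSide.faceSide_mem_edgeSet hf j) hm
  have hn : ¬ D.IsInnerFace (faceNbr f j) := fun hn ↦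
    faceNbr_ne f j (hchord _ _ (j + 2) j hn hf (faceSide_faceNbr f j) (by rwa [faceSide_faceNbr])).symm.symm
  rcases hcover f j hf hn hA with h | h | h | h
  · exact (not_mem_bichromaticEdges_of_forall (Or.inl fun x hx ↦ mem_slitColoured_of_mem (Or.inl (h x hx))) hb).elim
  · exact (not_mem_bichromaticEdges_of_forall (Or.inr fun x hx ↦ hX₁ x (h x hx)) hb).elim
  · exact h
  · exact (hT ⟨hf, Or.inr (Or.inl ⟨j, h⟩)⟩).elim

/-- **A bichromatic gap edge is unexplored**: an explored wired edge was followed, so both its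
endpoints are on the left bank. [cite: Smirnov2001, §2] -/
theorem exploredEdge_ne_of_mem_bichromaticEdges {e : Sym2 (Site 2)}
    (hb : e ∈ bichromaticEdges (slitColoured hD X₂ ω₀ n ω))
    (he : e ∈ (discreteDomainGraph D.Ω D.δ).edgeSet) (hA : ∀ x ∈ e, x ∈ D.zdArcA) {i : ℕ}
    (hi : i < min n (exitTime hD ω₀)) : exploredEdge hD ω₀ i ≠ e := by
  rintro rfl
  obtain ⟨a, b, hab, -, hb'⟩ := hb
  refine hb' (mem_slitColoured_of_mem (Or.inr (mem_leftBank_of_exploredEdge_mem hi (mem_bcBondConfig_of_arcA he hA) ?_)))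
  rw [hab]; exact Sym2.mem_mk_right _ _

/-! ### The covering half of the dichotomy -/

/-- **No slit crossing forces a dual slit crossing.**  For admissible data, a prefix (`ω₀`, `n`),
sets of sites `X₁, X₂` and designated wired edge sets `𝒢` (gap) and `ℱ` (far) such that: gap edges
are wired sides of inner faces; no wired edge of `Ω_δ` is a side of two inner faces; every wired
side of an inner face towards a non-inner face lies inside `X₂`, inside `X₁`, in `𝒢` or in `ℱ`;
and some lattice walk from the start vertex `a` to a site of `X₁`, with no repeated edge, passes
every gap edge and otherwise only edges inside `X₂` or inside `X₁` — every configuration without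
a slit crossing from `X₁` to `X₂ ∪ leftBank` has a dual slit crossing from a gap face to a target
face. [cite: BollobasRiordan2006, Ch. 3, Lemma 1] -/
theorem mem_dualSlitCrossing_of_not_mem_slitCrossing
    (h𝒢A : ∀ e ∈ 𝒢, ∀ x ∈ e, x ∈ D.zdArcA)
    (h𝒢in : ∀ e ∈ 𝒢, ∃ (f : Site 2) (j : Fin 4), D.IsInnerFace f ∧ faceSide f j = e)
    (hchord : ∀ f f' : Site 2, ∀ j j' : Fin 4, D.IsInnerFace f → D.IsInnerFace f' →
      faceSide f j = faceSide f' j' → (∀ x ∈ faceSide f j, x ∈ D.zdArcA) → f = f')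
    (hcover : ∀ (f : Site 2) (j : Fin 4), D.IsInnerFace f → ¬ D.IsInnerFace (faceNbr f j) →
      (∀ x ∈ faceSide f j, x ∈ D.zdArcA) → (∀ x ∈ faceSide f j, x ∈ X₂) ∨
        (∀ x ∈ faceSide f j, x ∈ X₁) ∨ faceSide f j ∈ 𝒢 ∨ faceSide f j ∈ ℱ)
    (hq : ∃ x ∈ X₁, ∃ q : (zdGraph 2).Walk (startCorner hD).1 x, q.edges.Nodup ∧
      (∀ e ∈ 𝒢, e ∈ q.edges) ∧ ∀ e ∈ q.edges, e ∈ 𝒢 ∨ (∀ x ∈ e, x ∈ X₂) ∨ (∀ x ∈ e, x ∈ X₁))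
    (hω : ω ∉ slitCrossing hD X₁ X₂ ω₀ n) : ω ∈ dualSlitCrossing hD 𝒢 ℱ ω₀ n := by
  classical
  by_contra hdual
  set c := slitColoured hD X₂ ω₀ n ω with hc
  set β := D.bcBondConfig (freeze hD ω₀ n ω) with hβ
  have hX₁ : ∀ x ∈ X₁, x ∉ c := fun x hx hcx ↦ hω ⟨x, hx, hcx⟩
  -- the dual cluster `K` of the sources
  set K : Set (Site 2) := {f | ∃ f₀ ∈ dualSlitSource hD 𝒢 ω₀ n, (dualSlitGraph hD ω₀ n ω).Reachable f₀ f}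
    with hK
  have hKin : ∀ f ∈ K, D.IsInnerFace f := fun f ⟨f₀, hf₀, hr⟩ ↦ isInnerFace_of_reachable hf₀.1 hr
  have hKT : ∀ f ∈ K, f ∉ dualSlitTarget hD ℱ ω₀ n := fun f ⟨f₀, hf₀, hr⟩ hfT ↦
    hdual ⟨f₀, hf₀, f, hfT, hr⟩
  have hKstep : ∀ f ∈ K, ∀ j, faceSide f j ∉ β → faceNbr f j ∈ K := fun f hf j hj ↦ by
    obtain ⟨f₀, hf₀, hr⟩ := hf
    exact ⟨f₀, hf₀, hr.trans (dualSlitGraph_adj_faceNbr (hKin f ⟨f₀, hf₀, hr⟩)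
      (isInnerFace_faceNbr_of_not_mem_target (hKin f ⟨f₀, hf₀, hr⟩) (hKT f ⟨f₀, hf₀, hr⟩) hj) hj).reachable⟩
  have hKfin : K.Finite :=
    (finite_hasAllSides (D := D) hD.isBounded hD.delta_pos).subset fun f hf ↦ hKin f hf
  set Kf := hKfin.toFinset with hKf
  have memKf : ∀ f, f ∈ Kf ↔ f ∈ K := fun f ↦ by rw [hKf, Set.Finite.mem_toFinset]
  -- bichromatic sides of faces of `K`: crossed ones (`T`) and gap ones (`Dg`)
  set P := Kf ×ˢ (Finset.univ : Finset (Fin 4)) with hP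
  set Bi := P.filter fun x ↦ faceSide x.1 x.2 ∈ bichromaticEdges c with hBi
  set T := P.filter fun x ↦ faceSide x.1 x.2 ∈ bichromaticEdges c ∧ faceSide x.1 x.2 ∉ β with hT
  set Dg := P.filter fun x ↦ faceSide x.1 x.2 ∈ bichromaticEdges c ∧ faceSide x.1 x.2 ∈ 𝒢 with hDg
  have h𝒢β : ∀ e ∈ 𝒢, e ∈ β := fun e he ↦ by
    obtain ⟨f, j, hf, rfl⟩ := h𝒢in e he
    exact mem_bcBondConfig_freeze_of_zdArcA (IsInnerFaceSide.faceSide_mem_edgeSet hf j) (h𝒢A _ he)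
  have hsplit : Bi = T ∪ Dg := by
    rw [hT, hDg, ← Finset.filter_or, hBi]
    refine Finset.filter_congr fun x hx ↦ ⟨fun hb ↦ ?_, fun h ↦ h.elim And.left And.left⟩
    have hxK : x.1 ∈ K := (memKf _).1 (Finset.mem_product.1 hx).1
    by_cases hm : faceSide x.1 x.2 ∈ β
    · exact Or.inr ⟨hb, mem_gap_of_bichromatic_of_mem hchord hcover hX₁ (hKin _ hxK) (hKT _ hxK) hb hm⟩
    · exact Or.inl ⟨hb, hm⟩
  have hdisj : Disjoint T Dg := by
    rw [hT, hDg, Finset.disjoint_filter]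
    exact fun x _ h1 h2 ↦ h1.2 (h𝒢β _ h2.2)
  -- (1) even number of bichromatic sides in total
  have hBi_even : Even Bi.card := by
    rw [hBi, Finset.card_filter, hP, Finset.sum_product]
    refine Finset.even_sum _ fun f _ ↦ ?_
    rw [← Finset.card_filter]
    exact even_card_bichromatic_faceSide c f
  -- (2) crossed bichromatic sides pair up across the side
  have hT_even : Even T.card := by
    rw [← ZMod.natCast_eq_zero_iff_even, Finset.card_eq_sum_ones, Nat.cast_sum]
    refine Finset.sum_involution (fun x _ ↦ (faceNbr x.1 x.2, x.2 + 2)) (fun _ _ ↦ by decide)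
      (fun x _ _ h ↦ faceNbr_ne x.1 x.2 (congr_arg Prod.fst h)) (fun x hx ↦ ?_) (fun x _ ↦ ?_)
    · rw [hT, Finset.mem_filter] at hx ⊢
      obtain ⟨hxP, hb, hm⟩ := hx
      have hxK : x.1 ∈ K := (memKf _).1 (Finset.mem_product.1 hxP).1
      refine ⟨Finset.mem_product.2 ⟨(memKf _).2 (hKstep _ hxK _ hm), Finset.mem_univ _⟩, ?_, ?_⟩
      · rwa [faceSide_faceNbr]
      · rwa [faceSide_faceNbr]
    · have h4 : x.2 + 2 + 2 = x.2 := by generalize x.2 = k; revert k; decide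
      simp only [faceNbr_faceNbr, h4]
  -- (3) bichromatic gap sides ↔ bichromatic gap edges, an odd number along the wired path
  obtain ⟨x, hx, q, hqnd, h𝒢q, hq𝒢⟩ := hq
  set Gb := q.edges.toFinset.filter fun e ↦ e ∈ bichromaticEdges c with hGb
  have hDg_card : Dg.card = Gb.card := by
    refine Finset.card_bij (fun x _ ↦ faceSide x.1 x.2) (fun y hy ↦ ?_) (fun y hy y' hy' h ↦ ?_)
      (fun e he ↦ ?_)
    · rw [hDg, Finset.mem_filter] at hy
      rw [hGb, Finset.mem_filter, List.mem_toFinset]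
      exact ⟨h𝒢q _ hy.2.2, hy.2.1⟩
    · rw [hDg, Finset.mem_filter] at hy hy'
      have hyK : y.1 ∈ K := (memKf _).1 (Finset.mem_product.1 hy.1).1
      have hy'K : y'.1 ∈ K := (memKf _).1 (Finset.mem_product.1 hy'.1).1
      have h1 : y.1 = y'.1 := hchord _ _ _ _ (hKin _ hyK) (hKin _ hy'K) h (h𝒢A _ hy.2.2)
      refine Prod.ext h1 (faceSide_injective y'.1 ?_)
      rw [h1] at h
      exact h
    · rw [hGb, Finset.mem_filter, List.mem_toFinset] at he
      obtain ⟨heq, hb⟩ := he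
      have he𝒢 : e ∈ 𝒢 := by
        rcases hq𝒢 e heq with h | h | h
        · exact h
        · exact (not_mem_bichromaticEdges_of_forall (Or.inl fun y hy ↦ mem_slitColoured_of_mem (Or.inl (h y hy))) hb).elim
        · exact (not_mem_bichromaticEdges_of_forall (Or.inr fun y hy ↦ hX₁ y (h y hy)) hb).elim
      obtain ⟨f, j, hf, rfl⟩ := h𝒢in e he𝒢
      have hfK : f ∈ K := by
        refine ⟨f, ⟨hf, j, he𝒢, fun i hi ↦ ?_⟩, SimpleGraph.Reachable.refl _⟩
        exact exploredEdge_ne_of_mem_bichromaticEdges hb (IsInnerFaceSide.faceSide_mem_edgeSet hf j) (h𝒢A _ he𝒢) hi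
      exact ⟨(f, j), by
        rw [hDg, Finset.mem_filter]
        exact ⟨Finset.mem_product.2 ⟨(memKf _).2 hfK, Finset.mem_univ _⟩, hb, he𝒢⟩, rfl⟩
  have hGb_odd : Odd Gb.card := by
    have hlen : Gb.card = (q.edges.filter fun e ↦ decide (e ∈ bichromaticEdges c)).length := by
      have hGb' : Gb = (q.edges.filter fun e ↦ decide (e ∈ bichromaticEdges c)).toFinset := by
        ext e
        simp only [hGb, Finset.mem_filter, List.mem_toFinset, List.mem_filter, decide_eq_true_eq]
      rw [hGb', List.toFinset_card_of_nodup (hqnd.filter _)]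
    have hpar := walk_bichromatic_parity c q
    have hca : (startCorner hD).1 ∈ c :=
      mem_slitColoured_of_mem (Or.inr (fst_cornerOrbit_mem_leftBank (i := 0) (Nat.zero_le _)))
    rw [if_pos hca, if_neg (hX₁ x hx), add_zero, ← hlen] at hpar
    exact ZMod.natCast_eq_one_iff_odd.1 hpar
  -- parity contradiction
  have hcard : Bi.card = T.card + Dg.card := by rw [hsplit, Finset.card_union_of_disjoint hdisj]
  rw [hcard, hDg_card] at hBi_even
  exact (Nat.not_even_iff_odd.2 hGb_odd) ((Nat.even_add.1 hBi_even).1 hT_even)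

/-- **The covering half of the exact slit duality**: under the hypotheses of
`mem_dualSlitCrossing_of_not_mem_slitCrossing`, the slit crossing event and the dual slit crossing
event cover everything. [cite: BollobasRiordan2006, Ch. 3, Lemma 1] -/
theorem slitCrossing_union_dualSlitCrossing
    (h𝒢A : ∀ e ∈ 𝒢, ∀ x ∈ e, x ∈ D.zdArcA)
    (h𝒢in : ∀ e ∈ 𝒢, ∃ (f : Site 2) (j : Fin 4), D.IsInnerFace f ∧ faceSide f j = e)
    (hchord : ∀ f f' : Site 2, ∀ j j' : Fin 4, D.IsInnerFace f → D.IsInnerFace f' →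
      faceSide f j = faceSide f' j' → (∀ x ∈ faceSide f j, x ∈ D.zdArcA) → f = f')
    (hcover : ∀ (f : Site 2) (j : Fin 4), D.IsInnerFace f → ¬ D.IsInnerFace (faceNbr f j) →
      (∀ x ∈ faceSide f j, x ∈ D.zdArcA) → (∀ x ∈ faceSide f j, x ∈ X₂) ∨
        (∀ x ∈ faceSide f j, x ∈ X₁) ∨ faceSide f j ∈ 𝒢 ∨ faceSide f j ∈ ℱ)
    (hq : ∃ x ∈ X₁, ∃ q : (zdGraph 2).Walk (startCorner hD).1 x, q.edges.Nodup ∧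
      (∀ e ∈ 𝒢, e ∈ q.edges) ∧ ∀ e ∈ q.edges, e ∈ 𝒢 ∨ (∀ x ∈ e, x ∈ X₂) ∨ (∀ x ∈ e, x ∈ X₁)) :
    slitCrossing hD X₁ X₂ ω₀ n ∪ dualSlitCrossing hD 𝒢 ℱ ω₀ n = univ :=
  eq_univ_of_forall fun ω ↦ (em (ω ∈ slitCrossing hD X₁ X₂ ω₀ n)).imp id
    (mem_dualSlitCrossing_of_not_mem_slitCrossing h𝒢A h𝒢in hchord hcover hq)

end Covering

end EventIdentity

/-- **Registered form** (anchor `slitDuality_slitCrossing_union_dualSlitCrossing` of stmt-CriticalPhenomena-0746): the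
covering half of the exact slit duality — for admissible data, a prefix (`ω₀`, `n`), site sets `X₁, X₂` and designated
wired edge sets `𝒢` (gap), `ℱ` (far) satisfying the geometric hypotheses (gap edges are wired sides of inner faces; no wired
chord; wired boundary sides lie inside `X₂`, inside `X₁`, in `𝒢` or in `ℱ`; a wired boundary walk from `a` to `X₁`
through the gap edges), every configuration has a slit crossing `X₁ ↔ X₂ ∪ leftBank` or a dual slit crossing from a gap
face to a target face. [cite: BollobasRiordan2006, Ch. 3, Lemma 1] -/
theorem slitDuality_slitCrossing_union_dualSlitCrossing : ∀ {D : Literature.Probability.LatticeModels.DiscreteDobrushin} (hD : D.IsZdAdmissible) (X₁ X₂ : Set (Literature.Probability.LatticeModels.Site 2)) (𝒢 ℱ : Set (Sym2 (Literature.Probability.LatticeModels.Site 2))) (ω₀ : Literature.Probability.Percolation.BondConfig (Literature.Probability.LatticeModels.Site 2)) (n : ℕ), (∀ e ∈ 𝒢, ∀ x ∈ e, x ∈ D.zdArcA) → (∀ e ∈ 𝒢, ∃ (f : Literature.Probability.LatticeModels.Site 2) (j : Fin 4), D.IsInnerFace f ∧ EventIdentity.faceSide f j = e) → (∀ f f'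 : Literature.Probability.LatticeModels.Site 2, ∀ j j' : Fin 4, D.IsInnerFace f → D.IsInnerFace f' → EventIdentity.faceSide f j = EventIdentity.faceSide f' j' → (∀ x ∈ EventIdentity.faceSide f j, x ∈ D.zdArcA) → f = f') → (∀ (f : Literature.Probability.LatticeModels.Site 2) (j : Fin 4), D.IsInnerFace f → ¬ D.IsInnerFace (EventIdentity.faceNbr f j) → (∀ x ∈ EventIdentity.faceSide f j, x ∈ D.zdArcA) → (∀ x ∈ EventIdentity.faceSide f j, x ∈ X₂) ∨ (∀ x ∈ EventIdentity.faceSide f j, x ∈ X₁) ∨ EventIdentity.faceSide f j ∈ 𝒢 ∨ EventIdentity.faceSide f j ∈ ℱ) → (∃ x ∈ X₁, ∃ q : (Literature.Probability.LatticeModels.zdGraph 2).Walk (Literature.Probability.LatticeModels.DiscreteDobrushin.startCorner hD).1 x, q.edges.Nodup ∧ (∀ e ∈ 𝒢, e ∈ q.edges) ∧ ∀ e ∈ q.edges, e ∈ 𝒢 ∨ (∀ x ∈ e, x ∈ X₂) ∨ (∀ x ∈ e, x ∈ X₁)) → EventIdentity.slitCrossing hD X₁ X₂ ω₀ n ∪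 EventIdentity.dualSlitCrossing hD 𝒢 ℱ ω₀ n = Set.univ :=
  fun hD X₁ X₂ 𝒢 ℱ ω₀ n h𝒢A h𝒢in hchord hcover hq ↦
    EventIdentity.slitCrossing_union_dualSlitCrossing (hD := hD) (X₁ := X₁) (X₂ := X₂) (𝒢 := 𝒢) (ℱ := ℱ)
      (ω₀ := ω₀) (n := n) h𝒢A h𝒢in hchord hcover hq

end Summit.CriticalPhenomena.CardyFormulaZ2.Cruxes.CardyRigidity.CrossingMartingale

end
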